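import Mathlib.Analysis.PSeries
import Literature.NumberTheory.LFunctions.PlateauMollifier
import HarnessLib

/-!
# Uniform decay of the coprime harmonic Möbius sum `∑_{n ≤ N, (n,k)=1} μ(n)/n`

Topic `Literature/NumberTheory/Sieve`. Everything in this file is PROVED (theorems only: no named
facts, no new definitions).

**Main result** (`CoprimeMoebiusDecay.abs_sum_coprimeMoebiusInv_le`, §D). If
`|M(J)| ≤ C₁ e^{-c₀√log J}` for every natural `J`, where `M(J) = ∑_{j ≤ J} μ(j)/j` (such
absolute `c₀ > 0`, `C₁` exist:
`CoprimeMoebiusDecay.exists_abs_moebiusInvSum_le_exp`, §B, which is the tree's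
`Literature.NumberTheory.LFunctions.abs_sum_moebius_div_le_exp_neg_sqrt_log` — the classical
zero-free region — extended to all `J`), then for every `k ≥ 1` and every `N`

  `|∑_{n ≤ N, (n,k)=1} μ(n)/n| ≤ C₁ e^{c₀²} 2^{1/4} · exp(4 ∑_{p ∣ k} p^{-3/4}) · e^{-c₀ √log N}`,

completely uniform in `k`; and (`CoprimeMoebiusDecay.primeSum_le_of_le_rpow`, §C)
`∑_{p ∣ k} p^{-3/4} ≤ (4 + 2B)(log R + 1)^{1/4}` whenever `1 ≤ k ≤ R^B`, `R ≥ 1`, so that the whole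
`k`-dependence costs a factor `exp(O_B((log R)^{1/4})) = e^{o(√log R)}`. §E adds the absolute bound
`∑_{n ≤ N} n^{-3/4} ∏_{p ∣ n} (p-1)⁻¹ ≤ exp(8 ∑_n n^{-7/4})` (Euler product of a multiplicative
majorant), used for the `1/φ`-weighted sums. These are the engine of the tree's proof of
Goldston–Yıldırım's Lemma 2.1, (2.13) at `j = 1` (`GoldstonYildirimLemma21Proofs.lean`; (2.13) at
`j = 0` is proved independently in `GoldstonYildirimLemma21MoebiusSumProofs.lean`, and §§C–D would
give it again, without splitting the range of summation), and the
`k`-bookkeeping is exactly that paper's (proof of Lemma 2.1, (3.5): `|g_k(s)| ≪ exp((log k)^{1/4})`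
from "`∑_{p ∣ k} p^{-σ-1} ≪ ∑_{p < 2 log 2k} p^{-σ-1} ≪ (log k)^{-σ}`", `σ ≥ -1/4`),
with the contour
integral of the source replaced by the already-proved bound for `M`.

Proof of the main result. `μ·1_{(·,k)=1}/id = (1_{k^∞}/id) ⋆ (μ/id)` gives
`M_k(N) = ∑_{m ∣ k^∞, m ≤ N} M(⌊N/m⌋)/m` (tree:
`Literature.NumberTheory.LFunctions.PlateauMollifier.sum_coprimeMoebiusInv_eq`). The key decay
inequality (§A, `exp_neg_sqrt_log_div_le`) `e^{-c₀√log⌊N/m⌋} ≤ e^{c₀²} (2m)^{1/4} e^{-c₀√log N}`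
(from `N ≤ 2m⌊N/m⌋`, `√(a+b) ≤ √a + √b` and `c₀√x ≤ x/4 + c₀²`) reduces everything to Rankin's
trick `∑_{m ∣ k^∞} m^{-3/4} ≤ ∏_{p ∣ k} (1 - p^{-3/4})⁻¹`
(tree: `…PlateauMollifier.sum_factored_rpow_le`) `≤ exp(4 ∑_{p ∣ k} p^{-3/4})`, and
`∑_{p ∣ k} p^{-3/4} ≤ ∑_{n ≤ T} n^{-3/4} + ω(k) T^{-3/4} ≤ 4 T^{1/4} + ω(k) T^{-3/4}` with
`ω(k) log 2 ≤ log k` and `T = ⌊log R⌋ + 1` (§C). What is NOT here: anything specific to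
Goldston–Yıldırım (the `1/φ` weights, the assembly with `k ≤ R^B`): see
`GoldstonYildirimLemma21Proofs.lean`.

## References

* D. A. Goldston, C. Y. Yıldırım, *Higher correlations of divisor sums related to primes I:
  triple correlations*, Integers 3 (2003) A5 = arXiv:math/0111212, §3, proof of Lemma 2.1,
  eq. (3.5), p. 17. [GoldstonYildirim2001]
* H. L. Montgomery, R. C. Vaughan, *Multiplicative Number Theory I*, CUP 2007, §7.1 (Rankin's
  method). [MontgomeryVaughan2007]

## Mathlib / tree search

Mathlib: `EulerProduct.summable_and_hasSum_smoothNumbers_prod_primesBelow_tsum`,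
`Real.summable_nat_rpow`, `Real.tsum_le_of_sum_range_le`, `geom_sum_Ico_le_of_lt_one`,
`Finset.pow_card_le_prod`, `Nat.prod_primeFactors_dvd`, `Real.rpow_pow_comm`. Tree:
`Literature.NumberTheory.LFunctions.PlateauMollifier` §§2–3 (`coprimeMoebiusInvAF`, `factoredInvAF`,
`moebiusInvSum`, `sum_coprimeMoebiusInv_eq`, `sum_factored_rpow_le`),
`…MoebiusHarmonicSumBound` (`abs_sum_moebius_div_le_exp_neg_sqrt_log`); the only earlier bounds for
coprime Möbius harmonic sums were the `O(1)` ones of `CoprimeMoebiusLogSums.lean`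
(`CoprimeMoebius.abs_sum_coprime_moebius_div_le_two`) and the rough-number case of
`AsymptoticSieveForPrimesRoughMoebius.lean` (`lean search 'coprime.*oebius|Coprime.*moebius.*div'`).
-/

noncomputable section

open Finset Real ArithmeticFunction
open scoped ArithmeticFunction.Moebius

namespace Literature.NumberTheory.Sieve

namespace CoprimeMoebiusDecay

open Literature.NumberTheory.LFunctions.PlateauMollifier

/-! ### §A Elementary inequalities -/

/-- `√a ≤ √b + √c` whenever `a ≤ b + c` and `b, c ≥ 0`. [folklore] -/
theorem sqrt_le_sqrt_add_sqrt {a b c : ℝ} (hb : 0 ≤ b) (hc : 0 ≤ c) (h : a ≤ b + c) :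
    Real.sqrt a ≤ Real.sqrt b + Real.sqrt c := by
  have h1 : Real.sqrt a ≤ Real.sqrt (b + c) := Real.sqrt_le_sqrt h
  have h2 : Real.sqrt (b + c) ≤ Real.sqrt b + Real.sqrt c := by
    rw [Real.sqrt_le_left (by positivity)]
    nlinarith [Real.sq_sqrt hb, Real.sq_sqrt hc, Real.sqrt_nonneg b, Real.sqrt_nonneg c,
      mul_nonneg (Real.sqrt_nonneg b) (Real.sqrt_nonneg c)]
  exact h1.trans h2

/-- `√x ≤ δ x + 1/(4δ)` for `δ > 0`, `x ≥ 0` (AM–GM). [folklore] -/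
theorem sqrt_le_mul_add_inv {δ x : ℝ} (hδ : 0 < δ) (hx : 0 ≤ x) :
    Real.sqrt x ≤ δ * x + 1 / (4 * δ) := by
  have hs := Real.sq_sqrt hx
  have h4 : 0 < 4 * δ := by positivity
  rw [← sub_nonneg]
  have : δ * x + 1 / (4 * δ) - Real.sqrt x = δ * (Real.sqrt x - 1 / (2 * δ)) ^ 2 := by
    field_simp
    nlinarith [hs]
  rw [this]
  positivity

/-- **The key decay inequality.** For `1 ≤ m ≤ N` and `c₀ > 0`:
`exp(-c₀ √log ⌊N/m⌋) ≤ e^{c₀²} (2m)^{1/4} exp(-c₀ √log N)`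
(from `N ≤ 2 ⌊N/m⌋ m`, `√log N ≤ √log⌊N/m⌋ + √log(2m)` and `c₀ √log(2m) ≤ ¼ log(2m) + c₀²`).
[folklore] -/
theorem exp_neg_sqrt_log_div_le {c₀ : ℝ} (hc : 0 < c₀) {m N : ℕ} (hm : 1 ≤ m) (hmN : m ≤ N) :
    Real.exp (-c₀ * Real.sqrt (Real.log (N / m : ℕ))) ≤
      Real.exp (c₀ ^ 2) * (2 * (m : ℝ)) ^ (1 / 4 : ℝ) *
        Real.exp (-c₀ * Real.sqrt (Real.log N)) := by
  set q : ℕ := N / m with hq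
  have hq1 : 1 ≤ q := (Nat.one_le_div_iff (by omega)).2 hmN
  have hNq : (N : ℝ) ≤ 2 * (m : ℝ) * q := by
    have h1 : N < (q + 1) * m := by
      rw [hq]; exact Nat.lt_succ_iff.2 le_rfl |>.trans_le (by
        have := Nat.lt_div_mul_add (a := N) (b := m) (by omega)
        nlinarith [this])
    have h2 : (q + 1) * m ≤ 2 * m * q := by nlinarith
    exact_mod_cast (h1.le.trans h2)
  have hmR : (1 : ℝ) ≤ m := by exact_mod_cast hm
  have hqR : (1 : ℝ) ≤ q := by exact_mod_cast hq1
  have h2m : (1 : ℝ) ≤ 2 * m := by linarith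
  have hlogN : Real.log N ≤ Real.log q + Real.log (2 * m) := by
    have hNR : (0 : ℝ) < N := by exact_mod_cast (show 0 < N by omega)
    calc Real.log N ≤ Real.log (2 * m * q) := Real.log_le_log hNR hNq
      _ = Real.log q + Real.log (2 * m) := by
        rw [Real.log_mul (by positivity) (by positivity)]; ring
  have hsq : Real.sqrt (Real.log N) ≤ Real.sqrt (Real.log q) + Real.sqrt (Real.log (2 * m)) :=
    sqrt_le_sqrt_add_sqrt (Real.log_nonneg hqR) (Real.log_nonneg h2m) hlogN
  have hδ : 0 < 1 / (4 * c₀) := by positivity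
  have hamgm := sqrt_le_mul_add_inv hδ (Real.log_nonneg h2m)
  have h14 : 1 / (4 * (1 / (4 * c₀))) = c₀ := by field_simp
  rw [h14] at hamgm
  -- `-c₀ √log q ≤ -c₀ √log N + ¼ log(2m) + c₀²`
  have hexp : -c₀ * Real.sqrt (Real.log q) ≤
      c₀ ^ 2 + (1 / 4 : ℝ) * Real.log (2 * m) + -c₀ * Real.sqrt (Real.log N) := by
    have h1 := mul_le_mul_of_nonneg_left hamgm hc.le
    have h2 : c₀ * (1 / (4 * c₀) * Real.log (2 * m) + c₀) =
        (1 / 4 : ℝ) * Real.log (2 * m) + c₀ ^ 2 := by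
      field_simp
    rw [h2] at h1
    have h3 := mul_le_mul_of_nonneg_left hsq hc.le
    rw [mul_add] at h3
    linarith
  calc Real.exp (-c₀ * Real.sqrt (Real.log q))
      ≤ Real.exp (c₀ ^ 2 + (1 / 4 : ℝ) * Real.log (2 * m) + -c₀ * Real.sqrt (Real.log N)) :=
        Real.exp_le_exp.2 hexp
    _ = _ := by
        rw [Real.exp_add, Real.exp_add, Real.rpow_def_of_pos (by positivity), mul_comm (Real.log _)]

/-! ### §B The harmonic Möbius sum `M(J) = ∑_{j ≤ J} μ(j)/j ≪ exp(-c₀ √log J)` for all `J` -/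

/-- The tree's bound `|M(x)| ≤ C e^{-c√log x}` (`x ≥ 2`) extended to every natural `J`
(`M(0) = 0`, `M(1) = 1`). [folklore] -/
theorem exists_abs_moebiusInvSum_le_exp :
    ∃ c₀ : ℝ, 0 < c₀ ∧ ∃ C₁ : ℝ, 1 ≤ C₁ ∧ ∀ J : ℕ,
      |moebiusInvSum J| ≤ C₁ * Real.exp (-c₀ * Real.sqrt (Real.log J)) := by
  obtain ⟨c, hc, C, hC⟩ :=
    Literature.NumberTheory.LFunctions.abs_sum_moebius_div_le_exp_neg_sqrt_log
  refine ⟨c, hc, max C 1, le_max_right _ _, fun J => ?_⟩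
  rcases Nat.lt_or_ge J 2 with hJ | hJ
  · interval_cases J
    · rw [moebiusInvSum_zero, abs_zero]; positivity
    · rw [moebiusInvSum_one, Nat.cast_one, Real.log_one, Real.sqrt_zero, mul_zero, Real.exp_zero,
        mul_one, abs_one]
      exact le_max_right _ _
  · have h := hC J (by exact_mod_cast hJ)
    rw [← moebiusInvSum_eq_sum_Icc_floor] at h
    exact h.trans (mul_le_mul_of_nonneg_right (le_max_left _ _) (Real.exp_pos _).le)

/-! ### §C `∑_{n ≤ T} n^{-3/4} ≤ 4 T^{1/4}` and `P(k) = ∑_{p ∣ k} p^{-3/4} ≪_B (log R)^{1/4}` -/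

/-- `n^{-3/4} ≤ 4 (n^{1/4} - (n-1)^{1/4})` for `n ≥ 1` (concavity of `t^{1/4}`). [folklore] -/
theorem rpow_neg_le_four_mul_sub {n : ℕ} (hn : 1 ≤ n) :
    (n : ℝ) ^ (-(3 / 4 : ℝ)) ≤ 4 * ((n : ℝ) ^ (1 / 4 : ℝ) - ((n : ℝ) - 1) ^ (1 / 4 : ℝ)) := by
  set a := (n : ℝ) ^ (1 / 4 : ℝ) with ha
  set b := ((n : ℝ) - 1) ^ (1 / 4 : ℝ) with hb
  have hnR : (1 : ℝ) ≤ n := by exact_mod_cast hn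
  have hn0 : (0 : ℝ) ≤ n := by linarith
  have hn1 : (0 : ℝ) ≤ (n : ℝ) - 1 := by linarith
  have ha_pos : 0 < a := Real.rpow_pos_of_pos (by linarith) _
  have hb_nn : 0 ≤ b := Real.rpow_nonneg hn1 _
  have ha4 : a ^ 4 = n := by
    rw [ha, ← Real.rpow_natCast, ← Real.rpow_mul hn0]; norm_num
  have hb4 : b ^ 4 = n - 1 := by
    rw [hb, ← Real.rpow_natCast, ← Real.rpow_mul hn1]; norm_num
  have hba : b ≤ a := Real.rpow_le_rpow hn1 (by linarith) (by norm_num)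
  have hneg : (n : ℝ) ^ (-(3 / 4 : ℝ)) = (a ^ 3)⁻¹ := by
    rw [Real.rpow_neg hn0, ha, ← Real.rpow_natCast, ← Real.rpow_mul hn0]; norm_num
  rw [hneg]
  have hab : 0 ≤ a - b := sub_nonneg.2 hba
  have hdiff : a ^ 4 - b ^ 4 = 1 := by rw [ha4, hb4]; ring
  have hfac : (1 : ℝ) = (a - b) * (a ^ 3 + a ^ 2 * b + a * b ^ 2 + b ^ 3) := by
    rw [← hdiff]; ring
  have hsum : a ^ 3 + a ^ 2 * b + a * b ^ 2 + b ^ 3 ≤ 4 * a ^ 3 := by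
    have h1 : a ^ 2 * b ≤ a ^ 2 * a := mul_le_mul_of_nonneg_left hba (sq_nonneg a)
    have h2 : b ^ 2 ≤ a ^ 2 := pow_le_pow_left₀ hb_nn hba 2
    have h2' : a * b ^ 2 ≤ a * a ^ 2 := mul_le_mul_of_nonneg_left h2 ha_pos.le
    have h3 : b ^ 3 ≤ a ^ 3 := pow_le_pow_left₀ hb_nn hba 3
    nlinarith
  have hkey : 1 ≤ (a - b) * (4 * a ^ 3) := by
    calc (1 : ℝ) = (a - b) * (a ^ 3 + a ^ 2 * b + a * b ^ 2 + b ^ 3) := hfac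
      _ ≤ (a - b) * (4 * a ^ 3) := mul_le_mul_of_nonneg_left hsum hab
  have ha3 : 0 < a ^ 3 := pow_pos ha_pos 3
  rw [inv_eq_one_div, div_le_iff₀ ha3]
  linarith

/-- `∑_{n=1}^{T} n^{-3/4} ≤ 4 T^{1/4}`. [folklore] -/
theorem sum_Icc_rpow_neg_le (T : ℕ) :
    ∑ n ∈ Icc 1 T, (n : ℝ) ^ (-(3 / 4 : ℝ)) ≤ 4 * (T : ℝ) ^ (1 / 4 : ℝ) := by
  induction T with
  | zero =>
    rw [show Icc 1 0 = (∅ : Finset ℕ) by rfl, Finset.sum_empty, Nat.cast_zero,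
      Real.zero_rpow (by norm_num), mul_zero]
  | succ T ih =>
    rw [Finset.sum_Icc_succ_top (by omega), Nat.cast_succ]
    have h := rpow_neg_le_four_mul_sub (n := T + 1) (by omega)
    push_cast at h
    rw [add_sub_cancel_right] at h
    linarith

/-- `P(k) ≤ 4 T^{1/4} + ω(k) T^{-3/4}` for every natural `T ≥ 1` (the primes `≤ T` contribute at
most `∑_{n ≤ T} n^{-3/4}`, each of the others at most `T^{-3/4}`); this is GY's
"`∑_{p ∣ k} p^{-σ-1} ≪ ∑_{p < 2 log 2k} p^{-σ-1} ≪ (log k)^{-σ}`" (p. 17). [folklore] -/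
theorem primeSum_le (k : ℕ) {T : ℕ} (hT : 1 ≤ T) :
    ∑ p ∈ k.primeFactors, (p : ℝ) ^ (-(3 / 4 : ℝ)) ≤
      4 * (T : ℝ) ^ (1 / 4 : ℝ) + k.primeFactors.card * (T : ℝ) ^ (-(3 / 4 : ℝ)) := by
  rw [← Finset.sum_filter_add_sum_filter_not k.primeFactors (fun p => p ≤ T)]
  refine add_le_add ?_ ?_
  · calc ∑ p ∈ k.primeFactors.filter (fun p => p ≤ T), (p : ℝ) ^ (-(3 / 4 : ℝ))
        ≤ ∑ n ∈ Icc 1 T, (n : ℝ) ^ (-(3 / 4 : ℝ)) := by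
          apply Finset.sum_le_sum_of_subset_of_nonneg
          · intro p hp
            rw [Finset.mem_filter] at hp
            rw [Finset.mem_Icc]
            exact ⟨(Nat.prime_of_mem_primeFactors hp.1).one_lt.le, hp.2⟩
          · intro i _ _
            exact Real.rpow_nonneg (Nat.cast_nonneg i) _
      _ ≤ 4 * (T : ℝ) ^ (1 / 4 : ℝ) := sum_Icc_rpow_neg_le T
  · calc ∑ p ∈ k.primeFactors.filter (fun p => ¬p ≤ T), (p : ℝ) ^ (-(3 / 4 : ℝ))
        ≤ ∑ p ∈ k.primeFactors.filter (fun p => ¬p ≤ T), (T : ℝ) ^ (-(3 / 4 : ℝ)) := by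
          apply Finset.sum_le_sum
          intro p hp
          rw [Finset.mem_filter, not_le] at hp
          exact Real.rpow_le_rpow_of_nonpos (by exact_mod_cast (show 0 < T by omega))
            (by exact_mod_cast hp.2.le) (by norm_num)
      _ = ((k.primeFactors.filter (fun p => ¬p ≤ T)).card : ℝ) * (T : ℝ) ^ (-(3 / 4 : ℝ)) := by
          rw [Finset.sum_const, nsmul_eq_mul]
      _ ≤ k.primeFactors.card * (T : ℝ) ^ (-(3 / 4 : ℝ)) := by
          apply mul_le_mul_of_nonneg_right _ (Real.rpow_nonneg (Nat.cast_nonneg _) _)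
          exact_mod_cast Finset.card_le_card (Finset.filter_subset _ _)

/-- **`P(k) ≤ (4 + 2B) (log R + 1)^{1/4}`** when `1 ≤ k ≤ R^B`, `R ≥ 1` (take `T = ⌊log R⌋ + 1` in
`primeSum_le` and `ω(k) ≤ log k/log 2 ≤ 2 B log R`). [folklore] -/
theorem primeSum_le_of_le_rpow {B : ℝ} (hB : 0 < B) {k : ℕ} (hk : 1 ≤ k) {R : ℝ} (hR : 1 ≤ R)
    (hkR : (k : ℝ) ≤ R ^ B) :
    ∑ p ∈ k.primeFactors, (p : ℝ) ^ (-(3 / 4 : ℝ)) ≤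
      (4 + 2 * B) * (Real.log R + 1) ^ (1 / 4 : ℝ) := by
  set L := Real.log R with hL
  have hL0 : 0 ≤ L := Real.log_nonneg hR
  set T : ℕ := ⌊L⌋₊ + 1 with hTdef
  have hT1 : 1 ≤ T := by omega
  have hTR : (T : ℝ) ≤ L + 1 := by
    rw [hTdef]; push_cast; linarith [Nat.floor_le hL0]
  have hLT : L ≤ T := by
    rw [hTdef]; push_cast; linarith [Nat.lt_floor_add_one L]
  have hT0 : (0 : ℝ) < T := by exact_mod_cast (show 0 < T by omega)
  -- `ω(k) log 2 ≤ log k ≤ B L`, so `ω(k) ≤ 2 B L` (this step is also the tree's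
  -- `GreenTao2008.SharpGY.card_primeFactors_mul_log_two_le`, not imported to keep this file light)
  have hω : (k.primeFactors.card : ℝ) ≤ 2 * B * L := by
    have h1 : (k.primeFactors.card : ℝ) * Real.log 2 ≤ Real.log k := by
      have h3 : 2 ^ k.primeFactors.card ≤ k := by
        calc 2 ^ k.primeFactors.card ≤ ∏ p ∈ k.primeFactors, p :=
              Finset.pow_card_le_prod k.primeFactors (fun p => p) 2
                (fun p hp => (Nat.prime_of_mem_primeFactors hp).two_le)
          _ ≤ k := Nat.le_of_dvd (by omega) (Nat.prod_primeFactors_dvd k)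
      have h4 : ((2 : ℝ) ^ k.primeFactors.card) ≤ k := by exact_mod_cast h3
      rw [← Real.log_pow]
      exact Real.log_le_log (by positivity) h4
    have h2 : Real.log k ≤ B * L := by
      calc Real.log k ≤ Real.log (R ^ B) :=
            Real.log_le_log (by exact_mod_cast (show 0 < k by omega)) hkR
        _ = B * L := by rw [Real.log_rpow (by linarith)]
    have hlog2 : (1 / 2 : ℝ) < Real.log 2 := by
      have := Real.log_two_gt_d9; linarith
    have hc0 : (0 : ℝ) ≤ k.primeFactors.card := Nat.cast_nonneg _
    nlinarith
  have hP := primeSum_le k hT1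
  -- `ω(k) T^{-3/4} ≤ 2 B L T^{-3/4} ≤ 2 B T^{1/4}`
  have hT14 : 0 ≤ (T : ℝ) ^ (1 / 4 : ℝ) := Real.rpow_nonneg hT0.le _
  have hsplit : (T : ℝ) ^ (1 / 4 : ℝ) = T * (T : ℝ) ^ (-(3 / 4 : ℝ)) := by
    rw [show (1 / 4 : ℝ) = 1 + -(3 / 4 : ℝ) by norm_num, Real.rpow_add hT0, Real.rpow_one]
  have h2 : (k.primeFactors.card : ℝ) * (T : ℝ) ^ (-(3 / 4 : ℝ)) ≤
      2 * B * (T : ℝ) ^ (1 / 4 : ℝ) := by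
    rw [hsplit]
    have hTn : 0 ≤ (T : ℝ) ^ (-(3 / 4 : ℝ)) := Real.rpow_nonneg hT0.le _
    calc (k.primeFactors.card : ℝ) * (T : ℝ) ^ (-(3 / 4 : ℝ))
        ≤ 2 * B * L * (T : ℝ) ^ (-(3 / 4 : ℝ)) := mul_le_mul_of_nonneg_right hω hTn
      _ ≤ 2 * B * T * (T : ℝ) ^ (-(3 / 4 : ℝ)) := by
          apply mul_le_mul_of_nonneg_right _ hTn
          exact mul_le_mul_of_nonneg_left hLT (by positivity)
      _ = 2 * B * (T * (T : ℝ) ^ (-(3 / 4 : ℝ))) := by ring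
  -- `T^{1/4} ≤ (L+1)^{1/4}`
  have h3 : (T : ℝ) ^ (1 / 4 : ℝ) ≤ (L + 1) ^ (1 / 4 : ℝ) :=
    Real.rpow_le_rpow hT0.le hTR (by norm_num)
  calc ∑ p ∈ k.primeFactors, (p : ℝ) ^ (-(3 / 4 : ℝ))
        ≤ 4 * (T : ℝ) ^ (1 / 4 : ℝ) + k.primeFactors.card * (T : ℝ) ^ (-(3 / 4 : ℝ)) := hP
    _ ≤ 4 * (T : ℝ) ^ (1 / 4 : ℝ) + 2 * B * (T : ℝ) ^ (1 / 4 : ℝ) := by linarith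
    _ = (4 + 2 * B) * (T : ℝ) ^ (1 / 4 : ℝ) := by ring
    _ ≤ (4 + 2 * B) * (L + 1) ^ (1 / 4 : ℝ) :=
        mul_le_mul_of_nonneg_left h3 (by positivity)

/-- `(1 - p^{-3/4})⁻¹ ≤ exp(4 p^{-3/4})` for `p ≥ 2` (as `p^{-3/4} ≤ 2^{-3/4} ≤ 3/4`). [folklore] -/
theorem inv_one_sub_rpow_le_exp {p : ℕ} (hp : 2 ≤ p) :
    (1 - (p : ℝ) ^ (-(3 / 4 : ℝ)))⁻¹ ≤ Real.exp (4 * (p : ℝ) ^ (-(3 / 4 : ℝ))) := by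
  set x := (p : ℝ) ^ (-(3 / 4 : ℝ)) with hx
  have hp0 : (0 : ℝ) < p := by exact_mod_cast (show 0 < p by omega)
  have hx0 : 0 ≤ x := Real.rpow_nonneg hp0.le _
  -- `x ≤ 2^{-3/4}` and `(2^{-3/4})^4 = 1/8 < (3/4)^4`
  have hx2 : x ≤ (2 : ℝ) ^ (-(3 / 4 : ℝ)) :=
    Real.rpow_le_rpow_of_nonpos (by norm_num) (by exact_mod_cast hp) (by norm_num)
  have hy4 : ((2 : ℝ) ^ (-(3 / 4 : ℝ))) ^ 4 = 1 / 8 := by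
    rw [← Real.rpow_natCast, ← Real.rpow_mul (by norm_num)]; norm_num
  have hy0 : 0 ≤ (2 : ℝ) ^ (-(3 / 4 : ℝ)) := Real.rpow_nonneg (by norm_num) _
  have hy34 : (2 : ℝ) ^ (-(3 / 4 : ℝ)) ≤ 3 / 4 := by
    by_contra h
    push Not at h
    have : (3 / 4 : ℝ) ^ 4 < ((2 : ℝ) ^ (-(3 / 4 : ℝ))) ^ 4 :=
      pow_lt_pow_left₀ h (by norm_num) (by norm_num)
    rw [hy4] at this
    norm_num at this
  have hx34 : x ≤ 3 / 4 := hx2.trans hy34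
  have h1x : 0 < 1 - x := by linarith
  calc (1 - x)⁻¹ = 1 + x / (1 - x) := by field_simp; ring
    _ ≤ 1 + 4 * x := by
        have : x / (1 - x) ≤ 4 * x := by
          rw [div_le_iff₀ h1x]; nlinarith
        linarith
    _ ≤ Real.exp (4 * x) := by linarith [Real.add_one_le_exp (4 * x)]

/-- `∏_{p ∣ k} (1 - p^{-3/4})⁻¹ ≤ exp(4 P(k))`. [folklore] -/
theorem prod_inv_one_sub_rpow_le_exp (k : ℕ) :
    ∏ p ∈ k.primeFactors, (1 - (p : ℝ) ^ (-(3 / 4 : ℝ)))⁻¹ ≤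
      Real.exp (4 * ∑ p ∈ k.primeFactors, (p : ℝ) ^ (-(3 / 4 : ℝ))) := by
  rw [Finset.mul_sum, Real.exp_sum]
  refine Finset.prod_le_prod (fun p hp => ?_) (fun p hp => ?_)
  · have hp2 := (Nat.prime_of_mem_primeFactors hp).two_le
    have : (p : ℝ) ^ (-(3 / 4 : ℝ)) < 1 :=
      Real.rpow_lt_one_of_one_lt_of_neg (by exact_mod_cast (show 1 < p by omega)) (by norm_num)
    exact inv_nonneg.2 (by linarith)
  · exact inv_one_sub_rpow_le_exp (Nat.prime_of_mem_primeFactors hp).two_le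

/-! ### §D The coprime harmonic Möbius sum `M_k(N) = ∑_{i ≤ N, (i,k)=1} μ(i)/i` -/

/-- **Core bound at `j = 0`.** If `|M(J)| ≤ C₁ e^{-c₀√log J}` for all `J`, then for all `k ≠ 0`
and all `N`,
`|∑_{i ≤ N, (i,k)=1} μ(i)/i| ≤ C₁ e^{c₀²} 2^{1/4} · exp(4 P(k)) · exp(-c₀ √log N)`:
`M_k(N) = ∑_{m ∣ k^∞, m ≤ N} M(⌊N/m⌋)/m` (tree
`Literature.NumberTheory.LFunctions.PlateauMollifier.sum_coprimeMoebiusInv_eq`), the key decay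
inequality `exp_neg_sqrt_log_div_le`, and Rankin's trick
`∑_{m ∣ k^∞} m^{-3/4} ≤ ∏_{p ∣ k} (1 - p^{-3/4})⁻¹ ≤ exp(4 P(k))`. [folklore] -/
theorem abs_sum_coprimeMoebiusInv_le {c₀ C₁ : ℝ} (hc : 0 < c₀) (hC : 0 ≤ C₁)
    (hM : ∀ J : ℕ, |moebiusInvSum J| ≤ C₁ * Real.exp (-c₀ * Real.sqrt (Real.log J)))
    {k : ℕ} (hk : k ≠ 0) (N : ℕ) :
    |∑ i ∈ Ioc 0 N, coprimeMoebiusInvAF k i| ≤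
      C₁ * Real.exp (c₀ ^ 2) * (2 : ℝ) ^ (1 / 4 : ℝ) *
        Real.exp (4 * ∑ p ∈ k.primeFactors, (p : ℝ) ^ (-(3 / 4 : ℝ))) *
        Real.exp (-c₀ * Real.sqrt (Real.log N)) := by
  rw [sum_coprimeMoebiusInv_eq hk]
  set E := Real.exp (-c₀ * Real.sqrt (Real.log N)) with hE
  set A := C₁ * Real.exp (c₀ ^ 2) * (2 : ℝ) ^ (1 / 4 : ℝ) with hA
  have hA0 : 0 ≤ A := by positivity
  have hE0 : 0 ≤ E := (Real.exp_pos _).le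
  have hterm : ∀ m ∈ Ioc 0 N, |factoredInvAF k m * moebiusInvSum (N / m)| ≤
      A * E *
        (if m ≠ 0 ∧ m.primeFactors ⊆ k.primeFactors then (m : ℝ) ^ (-(3 / 4 : ℝ)) else 0) := by
    intro m hm
    rw [Finset.mem_Ioc] at hm
    have hm1 : 1 ≤ m := hm.1
    have hmR : (0 : ℝ) < m := by exact_mod_cast hm.1
    rw [abs_mul, abs_of_nonneg (factoredInvAF_nonneg k m), factoredInvAF_apply]
    split_ifs with hcond
    · have hkey := exp_neg_sqrt_log_div_le hc hm1 hm.2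
      have h1 : |moebiusInvSum (N / m)| ≤
          C₁ * (Real.exp (c₀ ^ 2) * (2 * (m : ℝ)) ^ (1 / 4 : ℝ) * E) :=
        (hM (N / m)).trans (mul_le_mul_of_nonneg_left hkey hC)
      have h2m : (2 * (m : ℝ)) ^ (1 / 4 : ℝ) = (2 : ℝ) ^ (1 / 4 : ℝ) * (m : ℝ) ^ (1 / 4 : ℝ) :=
        Real.mul_rpow (by norm_num) hmR.le
      have hm34 : (m : ℝ)⁻¹ * (m : ℝ) ^ (1 / 4 : ℝ) = (m : ℝ) ^ (-(3 / 4 : ℝ)) := by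
        rw [← Real.rpow_neg_one, ← Real.rpow_add hmR]; norm_num
      calc (m : ℝ)⁻¹ * |moebiusInvSum (N / m)|
          ≤ (m : ℝ)⁻¹ * (C₁ * (Real.exp (c₀ ^ 2) * (2 * (m : ℝ)) ^ (1 / 4 : ℝ) * E)) :=
            mul_le_mul_of_nonneg_left h1 (inv_nonneg.2 hmR.le)
        _ = A * E * ((m : ℝ)⁻¹ * (m : ℝ) ^ (1 / 4 : ℝ)) := by rw [h2m, hA]; ring
        _ = A * E * (m : ℝ) ^ (-(3 / 4 : ℝ)) := by rw [hm34]
    · simp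
  calc |∑ m ∈ Ioc 0 N, factoredInvAF k m * moebiusInvSum (N / m)|
      ≤ ∑ m ∈ Ioc 0 N, |factoredInvAF k m * moebiusInvSum (N / m)| :=
        Finset.abs_sum_le_sum_abs _ _
    _ ≤ ∑ m ∈ Ioc 0 N, A * E *
          (if m ≠ 0 ∧ m.primeFactors ⊆ k.primeFactors then (m : ℝ) ^ (-(3 / 4 : ℝ)) else 0) :=
        Finset.sum_le_sum hterm
    _ = A * E * ∑ m ∈ Ioc 0 N,
          (if m ≠ 0 ∧ m.primeFactors ⊆ k.primeFactors then (m : ℝ) ^ (-(3 / 4 : ℝ)) else 0) := by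
        rw [Finset.mul_sum]
    _ ≤ A * E * ∏ p ∈ k.primeFactors, (1 - (p : ℝ) ^ (-(3 / 4 : ℝ)))⁻¹ :=
        mul_le_mul_of_nonneg_left (sum_factored_rpow_le (by norm_num) k N) (by positivity)
    _ ≤ A * E * Real.exp (4 * ∑ p ∈ k.primeFactors, (p : ℝ) ^ (-(3 / 4 : ℝ))) :=
        mul_le_mul_of_nonneg_left (prod_inv_one_sub_rpow_le_exp k) (by positivity)
    _ = A * Real.exp (4 * ∑ p ∈ k.primeFactors, (p : ℝ) ^ (-(3 / 4 : ℝ))) * E := by ring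

/-! ### §E The multiplicative majorant `h(n) = n^{-3/4} ∏_{p ∣ n} (p-1)⁻¹` and its Euler product -/

/-- The factors `(p-1)⁻¹` lie in `[0, 1]`. [folklore] -/
theorem inv_sub_one_mem {p : ℕ} (hp : p.Prime) :
    (0 : ℝ) ≤ ((p : ℝ) - 1)⁻¹ ∧ ((p : ℝ) - 1)⁻¹ ≤ 1 := by
  have : (2 : ℝ) ≤ p := by exact_mod_cast hp.two_le
  exact ⟨inv_nonneg.2 (by linarith), inv_le_one_of_one_le₀ (by linarith)⟩

/-- `p^{-3/4} < 1` and `p^{-3/4} ≤ 3/4` for a prime `p`. [folklore] -/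
theorem rpow_neg_lt_one {p : ℕ} (hp : p.Prime) :
    (p : ℝ) ^ (-(3 / 4 : ℝ)) < 1 ∧ (p : ℝ) ^ (-(3 / 4 : ℝ)) ≤ 3 / 4 := by
  refine ⟨Real.rpow_lt_one_of_one_lt_of_neg (by exact_mod_cast hp.one_lt) (by norm_num), ?_⟩
  have hx2 : (p : ℝ) ^ (-(3 / 4 : ℝ)) ≤ (2 : ℝ) ^ (-(3 / 4 : ℝ)) :=
    Real.rpow_le_rpow_of_nonpos (by norm_num) (by exact_mod_cast hp.two_le) (by norm_num)
  have hy4 : ((2 : ℝ) ^ (-(3 / 4 : ℝ))) ^ 4 = 1 / 8 := by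
    rw [← Real.rpow_natCast, ← Real.rpow_mul (by norm_num)]; norm_num
  have hy34 : (2 : ℝ) ^ (-(3 / 4 : ℝ)) ≤ 3 / 4 := by
    by_contra h
    push Not at h
    have : (3 / 4 : ℝ) ^ 4 < ((2 : ℝ) ^ (-(3 / 4 : ℝ))) ^ 4 :=
      pow_lt_pow_left₀ h (by norm_num) (by norm_num)
    rw [hy4] at this
    norm_num at this
  exact hx2.trans hy34

section Majorant

variable {h : ℕ → ℝ}
  (hh : ∀ n : ℕ, h n = (n : ℝ) ^ (-(3 / 4 : ℝ)) * ∏ p ∈ n.primeFactors, ((p : ℝ) - 1)⁻¹)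
include hh

/-- `h ≥ 0`. [folklore] -/
theorem majorant_nonneg (n : ℕ) : 0 ≤ h n := by
  rw [hh]
  exact mul_nonneg (Real.rpow_nonneg (Nat.cast_nonneg n) _)
    (Finset.prod_nonneg fun _ hp => (inv_sub_one_mem (Nat.prime_of_mem_primeFactors hp)).1)

/-- `h(1) = 1`. [folklore] -/
theorem majorant_one : h 1 = 1 := by simp [hh]

/-- `h(0) = 0`. [folklore] -/
theorem majorant_zero : h 0 = 0 := by
  simp [hh, Real.zero_rpow (show (-(3 / 4 : ℝ)) ≠ 0 by norm_num)]

/-- `h` is multiplicative on coprime arguments. [folklore] -/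
theorem majorant_mul {m n : ℕ} (hmn : m.Coprime n) : h (m * n) = h m * h n := by
  rcases Nat.eq_zero_or_pos m with rfl | hm0
  · simp [majorant_zero hh]
  rcases Nat.eq_zero_or_pos n with rfl | hn0
  · simp [majorant_zero hh]
  rw [hh, hh m, hh n, Nat.Coprime.primeFactors_mul hmn,
    Finset.prod_union hmn.disjoint_primeFactors, Nat.cast_mul,
    Real.mul_rpow (Nat.cast_nonneg m) (Nat.cast_nonneg n)]
  ring

/-- `h(p^{j+1}) = (p^{-3/4})^{j+1} (p-1)⁻¹`. [folklore] -/
theorem majorant_prime_pow_succ {p : ℕ} (hp : p.Prime) (j : ℕ) :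
    h (p ^ (j + 1)) = ((p : ℝ) ^ (-(3 / 4 : ℝ))) ^ (j + 1) * ((p : ℝ) - 1)⁻¹ := by
  rw [hh, Nat.primeFactors_prime_pow (Nat.succ_ne_zero j) hp, Finset.prod_singleton, Nat.cast_pow,
    ← Real.rpow_pow_comm (Nat.cast_nonneg p)]

/-- `h(p^j) ≤ (p^{-3/4})^j`. [folklore] -/
theorem majorant_prime_pow_le {p : ℕ} (hp : p.Prime) (j : ℕ) :
    h (p ^ j) ≤ ((p : ℝ) ^ (-(3 / 4 : ℝ))) ^ j := by
  rcases Nat.eq_zero_or_pos j with rfl | hj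
  · rw [pow_zero, majorant_one hh, pow_zero]
  obtain ⟨i, rfl⟩ : ∃ i, j = i + 1 := ⟨j - 1, by omega⟩
  rw [majorant_prime_pow_succ hh hp]
  have hx : 0 ≤ ((p : ℝ) ^ (-(3 / 4 : ℝ))) ^ (i + 1) :=
    pow_nonneg (Real.rpow_nonneg (Nat.cast_nonneg p) _) _
  calc ((p : ℝ) ^ (-(3 / 4 : ℝ))) ^ (i + 1) * ((p : ℝ) - 1)⁻¹
      ≤ ((p : ℝ) ^ (-(3 / 4 : ℝ))) ^ (i + 1) * 1 :=
        mul_le_mul_of_nonneg_left (inv_sub_one_mem hp).2 hx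
    _ = _ := mul_one _

/-- `∑_j ‖h(p^j)‖` converges (geometric majorant). [folklore] -/
theorem summable_norm_majorant_prime_pow {p : ℕ} (hp : p.Prime) :
    Summable (fun j : ℕ => ‖h (p ^ j)‖) := by
  have hx0 : 0 ≤ (p : ℝ) ^ (-(3 / 4 : ℝ)) := Real.rpow_nonneg (Nat.cast_nonneg p) _
  refine Summable.of_nonneg_of_le (fun _ => norm_nonneg _) (fun j => ?_)
    (summable_geometric_of_lt_one hx0 (rpow_neg_lt_one hp).1)
  rw [Real.norm_eq_abs, abs_of_nonneg (majorant_nonneg hh _)]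
  exact majorant_prime_pow_le hh hp j

/-- The local factor: `∑_j h(p^j) ≤ exp(8 p^{-7/4})`
(`= 1 + (p-1)⁻¹ p^{-3/4}/(1 - p^{-3/4}) ≤ 1 + 4 (p-1)⁻¹ p^{-3/4} ≤ 1 + 8 p^{-7/4}`). [folklore] -/
theorem tsum_majorant_prime_pow_le {p : ℕ} (hp : p.Prime) :
    ∑' j : ℕ, h (p ^ j) ≤ Real.exp (8 * (p : ℝ) ^ (-(7 / 4 : ℝ))) := by
  set x := (p : ℝ) ^ (-(3 / 4 : ℝ)) with hx
  have hp0 : (0 : ℝ) < p := by exact_mod_cast hp.pos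
  have hp2 : (2 : ℝ) ≤ p := by exact_mod_cast hp.two_le
  have hx0 : 0 ≤ x := Real.rpow_nonneg hp0.le _
  obtain ⟨hx1, hx34⟩ := rpow_neg_lt_one hp
  have hq0 : 0 ≤ ((p : ℝ) - 1)⁻¹ := (inv_sub_one_mem hp).1
  have hpartial : ∀ K : ℕ, ∑ j ∈ Finset.range K, h (p ^ j) ≤ 1 + 4 * ((p : ℝ) - 1)⁻¹ * x := by
    intro K
    rcases Nat.eq_zero_or_pos K with rfl | hK
    · simp only [Finset.range_zero, Finset.sum_empty]
      nlinarith
    rw [Finset.range_eq_Ico, Finset.sum_eq_sum_Ico_succ_bot hK, pow_zero, majorant_one hh]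
    have h1 : ∑ j ∈ Finset.Ico 1 K, h (p ^ j) ≤ ((p : ℝ) - 1)⁻¹ * ∑ j ∈ Finset.Ico 1 K, x ^ j := by
      rw [Finset.mul_sum]
      refine Finset.sum_le_sum fun j hj => ?_
      obtain ⟨i, rfl⟩ : ∃ i, j = i + 1 := ⟨j - 1, by have := (Finset.mem_Ico.1 hj).1; omega⟩
      rw [majorant_prime_pow_succ hh hp, hx, mul_comm]
    have h2 : ∑ j ∈ Finset.Ico 1 K, x ^ j ≤ x ^ 1 / (1 - x) := geom_sum_Ico_le_of_lt_one hx0 hx1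
    have h3 : x ^ 1 / (1 - x) ≤ 4 * x := by
      rw [pow_one, div_le_iff₀ (by linarith)]
      nlinarith
    have h4 := mul_le_mul_of_nonneg_left (h2.trans h3) hq0
    linarith
  have hbound : 1 + 4 * ((p : ℝ) - 1)⁻¹ * x ≤ Real.exp (8 * (p : ℝ) ^ (-(7 / 4 : ℝ))) := by
    have h1 : ((p : ℝ) - 1)⁻¹ ≤ 2 * (p : ℝ)⁻¹ := by
      rw [inv_le_comm₀ (by linarith) (by positivity), mul_inv, inv_inv]
      nlinarith
    have h2 : (p : ℝ)⁻¹ * x = (p : ℝ) ^ (-(7 / 4 : ℝ)) := by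
      rw [hx, ← Real.rpow_neg_one, ← Real.rpow_add hp0]; norm_num
    have h3 : 4 * ((p : ℝ) - 1)⁻¹ * x ≤ 8 * (p : ℝ) ^ (-(7 / 4 : ℝ)) := by
      rw [← h2]
      nlinarith [mul_le_mul_of_nonneg_right h1 hx0]
    linarith [Real.add_one_le_exp (8 * (p : ℝ) ^ (-(7 / 4 : ℝ)))]
  exact (Real.tsum_le_of_sum_range_le (fun j => majorant_nonneg hh _) hpartial).trans hbound

end Majorant

/-- **`∑_{n ≤ N} n^{-3/4} ∏_{p ∣ n} (p-1)⁻¹ ≤ exp(8 ∑_n n^{-7/4})`**, an absolute constant (Euler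
product of the multiplicative majorant over the `(N+1)`-smooth numbers, by Mathlib's
`EulerProduct.summable_and_hasSum_smoothNumbers_prod_primesBelow_tsum`). [folklore] -/
theorem sum_majorant_le (N : ℕ) :
    ∑ n ∈ Ioc 0 N, (n : ℝ) ^ (-(3 / 4 : ℝ)) * ∏ p ∈ n.primeFactors, ((p : ℝ) - 1)⁻¹ ≤
      Real.exp (8 * ∑' n : ℕ, (n : ℝ) ^ (-(7 / 4 : ℝ))) := by
  set h : ℕ → ℝ := fun n => (n : ℝ) ^ (-(3 / 4 : ℝ)) * ∏ p ∈ n.primeFactors, ((p : ℝ) - 1)⁻¹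
    with hhdef
  have hh : ∀ n : ℕ, h n = (n : ℝ) ^ (-(3 / 4 : ℝ)) * ∏ p ∈ n.primeFactors, ((p : ℝ) - 1)⁻¹ :=
    fun n => rfl
  show ∑ n ∈ Ioc 0 N, h n ≤ _
  obtain ⟨-, hsum⟩ := EulerProduct.summable_and_hasSum_smoothNumbers_prod_primesBelow_tsum
    (majorant_one hh) (fun hmn => majorant_mul hh hmn)
    (fun hp => summable_norm_majorant_prime_pow hh hp) (N + 1)
  set A := Ioc 0 N with hA
  have hAmem : ∀ m ∈ A, m ∈ (N + 1).smoothNumbers := fun m hm => by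
    rw [hA, Finset.mem_Ioc] at hm
    exact Nat.mem_smoothNumbers_of_lt hm.1 (Nat.lt_succ_of_le hm.2)
  have h2 : ∑ m ∈ A, h m = ∑ x ∈ A.subtype (· ∈ (N + 1).smoothNumbers), h x := by
    rw [Finset.sum_subtype_eq_sum_filter]
    conv_lhs => rw [← Finset.filter_true_of_mem hAmem]
  rw [h2]
  have hsummable : Summable (fun n : ℕ => (n : ℝ) ^ (-(7 / 4 : ℝ))) :=
    Real.summable_nat_rpow.2 (by norm_num)
  calc ∑ x ∈ A.subtype (· ∈ (N + 1).smoothNumbers), h x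
      ≤ ∏ p ∈ (N + 1).primesBelow, ∑' j : ℕ, h (p ^ j) :=
        sum_le_hasSum _ (fun x _ => majorant_nonneg hh _) hsum
    _ ≤ ∏ p ∈ (N + 1).primesBelow, Real.exp (8 * (p : ℝ) ^ (-(7 / 4 : ℝ))) :=
        Finset.prod_le_prod (fun p _ => tsum_nonneg fun j => majorant_nonneg hh _)
          (fun p hp => tsum_majorant_prime_pow_le hh (Nat.prime_of_mem_primesBelow hp))
    _ = Real.exp (8 * ∑ p ∈ (N + 1).primesBelow, (p : ℝ) ^ (-(7 / 4 : ℝ))) := by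
        rw [Finset.mul_sum, Real.exp_sum]
    _ ≤ Real.exp (8 * ∑' n : ℕ, (n : ℝ) ^ (-(7 / 4 : ℝ))) := by
        gcongr
        exact hsummable.sum_le_tsum _ (fun n _ => Real.rpow_nonneg (Nat.cast_nonneg n) _)

end CoprimeMoebiusDecay

end Literature.NumberTheory.Sieve
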